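import Summits.ValiantsHypothesis.ValiantsHypothesis.Theorems.BarrierLeverChowHitsThinRowPartitionMinorsRStarRelabel

/-!
# Route BarrierLever — item `ChowHitsThinRowPartitionMinorsR` (stmt-ValiantsHypothesis-21850, budget
# `h·h`): a STAR of x-dedicated pair rows — affine defect ≤ 2·k + slack is hit

Helper file (`--supports stmt-ValiantsHypothesis-21850`; cell valiant-natproofs, rung V4, 𝒟-side;
seat val-np-p5 gen 28).  Closes NO item; definition-free; imports this seat's `…RStarRelabel`.

**`chowHitsHH_of_xdedStar`.**  Rows `u` (injective, thin) with a star of triangles — singleton rows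
`{a₀}`, `{x}` and pair rows `{a₀, x}` for `x ∈ B` — against columns `w` with a down-closed injective
monomial basis `U` (`det [U i ⊆ w j] ≠ 0`) containing a star of pair labels `{v₀, φ x}` (`x ∈ B`) and
the singleton of every used coordinate outside a set `Dx` with `|Dx| ≤ 2·|B|`: hit by `h·h` affine
forms.  Each pair row `{a₀, x}` is x-DEDICATED (label `{v₀, φ x} = {v₀} ⊔ {φ x}`, no gadget) and pays
for two public forms (`exists_starRelabel` + `chowHitsHH_of_labels_xded`, p695022).  With `|B| = 1`
this is `chowHitsHH_of_defectLeTwo`; in general it covers affine defect `≤ 2·star(Γ_U) + slack`,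
`Γ_U` = the graph of pair labels of the basis — e.g. every near-full layout on twin / co-twin column
families whose basis contains all pairs of the free coordinates (the extreme families `(h, h/2)` of
the numerics), since near-full rows always contain a full star (`exists_fullStar_of_nearFull`).
**`chowHitsHH_of_nearFull_labelStar`**: the near-full corollary (rows near-full, `h ≥ 3`; the label
star `K` and `Dx` with `|Dx| ≤ 2|K|`, `|K| + 1 ≤ #singles` are the only column-side hypotheses).

WHAT THIS IS NOT: item 21850 is NOT proved (a basis may have few pair labels: `Γ_U` can be a clique on
`≈ 2 log₂ h` free coordinates while the defect is `≈ h/2` — there the absorbed certificate AC″ is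
needed); nothing on items 21882 / 19717, on crux stmt-ValiantsHypothesis-14610, or on `VP` versus
`VNP`.
-/

set_option linter.dupNamespace false

namespace Summit.ValiantsHypothesis.ValiantsHypothesis.Theorems.BarrierLever.ChowThinHH

open Finset MvPolynomial

variable {h r : ℕ}

/-- **Star of x-dedicated pairs ⇒ hit** (see the module docstring). -/
theorem chowHitsHH_of_xdedStar (h r : ℕ) (u w : Fin r → Finset (Fin h))
    (hu : Function.Injective u) (hu2 : ∀ i, (u i).card ≤ 2)
    (U : Fin r → Finset (Fin h)) (hUinj : Function.Injective U)
    (hUdown : ∀ i (S : Finset (Fin h)), S ⊆ U i → ∃ i', U i' = S)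
    (hZ : (Matrix.of fun i j : Fin r => if U i ⊆ w j then (1 : ℂ) else 0).det ≠ 0)
    (a₀ : Fin h) (B : Finset (Fin h)) (haB : a₀ ∉ B)
    (σ : Fin h → Fin r) (hσ : ∀ x ∈ insert a₀ B, u (σ x) = {x})
    (ρ : Fin h → Fin r) (hρ : ∀ x ∈ B, u (ρ x) = {a₀, x})
    (v₀ : Fin h) (φ : Fin h → Fin h) (hφ : Set.InjOn φ B) (hv₀ : ∀ x ∈ B, φ x ≠ v₀)
    (hv₀U : ∃ j, U j = {v₀}) (hKU : ∀ x ∈ B, ∃ j, U j = {v₀, φ x})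
    (Dx : Finset (Fin h)) (hDx : Dx.card ≤ 2 * B.card)
    (hUsing : ∀ c ∈ Finset.univ.biUnion w, c ∉ Dx → ∃ i, U i = {c}) :
    ∃ ℓ : Fin (h * h) → MvPolynomial (Fin (h + h)) ℂ, (∀ k, (ℓ k).totalDegree ≤ 1) ∧
      (Matrix.of fun i j : Fin r => MvPolynomial.coeff
        (∑ a ∈ u i, Finsupp.single (Fin.castAdd h a) 1 +
          ∑ c ∈ w j, Finsupp.single (Fin.natAdd h c) 1) (∏ k, ℓ k)).det ≠ 0 := by
  classical
  obtain ⟨U', hU'inj, hU'down, hU'empty, hZ', hU'a, hU'σ, hU'ρ, hcost⟩ :=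
    exists_starRelabel u w hu U hUinj hUdown hZ a₀ B haB σ hσ ρ hρ v₀ φ hφ hv₀ hv₀U hKU Dx hUsing
  set Sing : Finset (Fin r) := Finset.univ.filter fun i : Fin r => (u i).card = 1 with hSing
  set Pairs : Finset (Fin r) := Finset.univ.filter fun i : Fin r => (u i).card = 2 with hPairs
  set Cu : Finset (Fin h) := Finset.univ.biUnion w with hCu
  have hxa : ∀ x ∈ B, x ≠ a₀ := fun x hx e => haB (e ▸ hx)
  have hρcard : ∀ x ∈ B, (u (ρ x)).card = 2 := fun x hx => by
    rw [hρ x hx, Finset.card_pair (hxa x hx).symm]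
  have hρinj : Set.InjOn ρ B := by
    intro x hx x' hx' e
    have e2 : ({a₀, x} : Finset (Fin h)) = {a₀, x'} :=
      (hρ x hx).symm.trans ((congrArg u e).trans (hρ x' hx'))
    have hx2 : x ∈ ({a₀, x'} : Finset (Fin h)) := by rw [← e2]; simp
    rcases Finset.mem_insert.mp hx2 with h1 | h1
    · exact absurd h1 (hxa x hx)
    · exact Finset.mem_singleton.mp h1
  have ha0 : a₀ ∈ insert a₀ B := Finset.mem_insert_self _ _
  refine chowHitsHH_of_labels_xded h r u w hu hu2 U' hU'inj hU'down hU'empty hZ' (B.image ρ) ?_ ?_ ?_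
  · intro i hi
    obtain ⟨x, hx, rfl⟩ := Finset.mem_image.mp hi
    exact hρcard x hx
  · intro i hi
    obtain ⟨x, hx, rfl⟩ := Finset.mem_image.mp hi
    have hxB : x ∈ insert a₀ B := Finset.mem_insert_of_mem hx
    refine ⟨σ a₀, σ x, by rw [hσ a₀ ha0, Finset.card_singleton],
      by rw [hσ x hxB, Finset.card_singleton], ?_, ?_, ?_⟩
    · rw [hρ x hx, hσ a₀ ha0, hσ x hxB]; rfl
    · rw [hU'ρ x hx, hU'a, hU'σ x hx]; rfl
    · rw [hU'a, hU'σ x hx]; exact Finset.disjoint_singleton.mpr (hv₀ x hx).symm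
  -- budget
  have hXsub : B.image ρ ⊆ Pairs := by
    intro i hi
    obtain ⟨x, hx, rfl⟩ := Finset.mem_image.mp hi
    exact Finset.mem_filter.mpr ⟨Finset.mem_univ _, hρcard x hx⟩
  have hXcard : (B.image ρ).card = B.card := Finset.card_image_of_injOn hρinj
  have hBle : B.card ≤ Pairs.card := by rw [← hXcard]; exact Finset.card_le_card hXsub
  have hSing_le : Sing.card ≤ h := by
    rw [← Finset.card_image_of_injective _ hu]
    refine (Finset.card_le_card ?_).trans
      (Finset.card_image_le.trans (by rw [Finset.card_univ, Fintype.card_fin]) :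
        (Finset.univ.image fun c : Fin h => ({c} : Finset (Fin h))).card ≤ h)
    intro S hS
    obtain ⟨i, hi, rfl⟩ := Finset.mem_image.mp hS
    obtain ⟨c, hc⟩ := Finset.card_eq_one.mp (Finset.mem_filter.mp hi).2
    exact Finset.mem_image.mpr ⟨c, Finset.mem_univ _, hc.symm⟩
  have hCu_h : Cu.card ≤ h := (Finset.card_le_univ _).trans (by rw [Fintype.card_fin])
  have hpairs : Pairs.card ≤ h.choose 2 := card_pairRows_le u hu
  have h3 := add_two_mul_choose_two h
  show (Sing.image U' ∪ Cu.image (fun c : Fin h => ({c} : Finset (Fin h)))).card +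
      2 * (Pairs \ B.image ρ).card ≤ h * h
  rw [Finset.card_sdiff_of_subset hXsub, hXcard]
  rcases le_max_iff.mp hcost with h1 | h1
  · omega
  · omega


/-- **Near-full rows contain a full star.**  If `h·h < #singles + h + 2·#pairs` and there is a
singleton row, then some singleton row `{a₀}` has ALL pair rows `{a₀, b}`, `{b}` ranging over the
other singleton rows.  (The 2-subsets of singleton coordinates that are not rows number
`≤ C(h,2) − #pairs < #singles / 2`, too few to touch every singleton coordinate; near-fullness
forces `#singles ≥ 1`.) -/
theorem exists_fullStar_of_nearFull (u : Fin r → Finset (Fin h)) (hu : Function.Injective u)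
    (hnear : h * h < (Finset.univ.filter fun i : Fin r => (u i).card = 1).card + h +
      2 * (Finset.univ.filter fun i : Fin r => (u i).card = 2).card) :
    ∃ i₀, (u i₀).card = 1 ∧ ∀ i, (u i).card = 1 → i ≠ i₀ → ∃ q, u q = u i₀ ∪ u i := by
  classical
  set Sing : Finset (Fin r) := Finset.univ.filter fun i : Fin r => (u i).card = 1 with hSing
  set P : Finset (Fin r) := Finset.univ.filter fun i : Fin r => (u i).card = 2 with hP
  set A : Finset (Fin h) := Sing.biUnion u with hA
  have hAcard : A.card = Sing.card := by
    rw [hA, Finset.card_biUnion]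
    · calc ∑ i ∈ Sing, (u i).card = ∑ i ∈ Sing, 1 :=
            Finset.sum_congr rfl fun i hi => (Finset.mem_filter.mp hi).2
        _ = Sing.card := by simp
    · intro i hi j hj hij
      obtain ⟨a, ha⟩ := Finset.card_eq_one.mp (Finset.mem_filter.mp hi).2
      obtain ⟨b, hb⟩ := Finset.card_eq_one.mp (Finset.mem_filter.mp hj).2
      show Disjoint (u i) (u j)
      rw [ha, hb, Finset.disjoint_singleton]
      intro e
      exact hij (hu (by rw [ha, hb, e]))
  set Miss : Finset (Finset (Fin h)) := (A.powersetCard 2).filter fun S => ∀ q, u q ≠ S with hMiss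
  -- pair rows and missing pairs are disjoint families of 2-subsets of `Fin h`
  have h1 : P.image u ∪ Miss ⊆ (Finset.univ : Finset (Fin h)).powersetCard 2 := by
    intro S hS
    rcases Finset.mem_union.mp hS with hS | hS
    · obtain ⟨i, hi, rfl⟩ := Finset.mem_image.mp hS
      exact Finset.mem_powersetCard.mpr ⟨Finset.subset_univ _, (Finset.mem_filter.mp hi).2⟩
    · exact Finset.powersetCard_mono (Finset.subset_univ A) (Finset.mem_filter.mp hS).1
  have h2 : Disjoint (P.image u) Miss := by
    rw [Finset.disjoint_left]
    intro S hS hS'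
    obtain ⟨i, -, rfl⟩ := Finset.mem_image.mp hS
    exact (Finset.mem_filter.mp hS').2 i rfl
  have hPM : P.card + Miss.card ≤ h.choose 2 := by
    have h3 := Finset.card_le_card h1
    rw [Finset.card_union_of_disjoint h2, Finset.card_image_of_injOn (fun i _ j _ e => hu e),
      Finset.card_powersetCard, Finset.card_univ, Fintype.card_fin] at h3
    exact h3
  by_contra hno
  -- every singleton coordinate lies in a missing pair
  have hcov : A ⊆ Miss.biUnion id := by
    intro a ha
    obtain ⟨i₀, hi₀S, hai₀⟩ := Finset.mem_biUnion.mp ha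
    have hi₀ : (u i₀).card = 1 := (Finset.mem_filter.mp hi₀S).2
    have hui₀ : u i₀ = {a} := by
      obtain ⟨a', ha'⟩ := Finset.card_eq_one.mp hi₀
      rw [ha'] at hai₀ ⊢
      rw [Finset.mem_singleton.mp hai₀]
    have hex : ∃ i, (u i).card = 1 ∧ i ≠ i₀ ∧ ∀ q, u q ≠ u i₀ ∪ u i := by
      by_contra hcon
      apply hno
      refine ⟨i₀, hi₀, fun i hi hne => ?_⟩
      by_contra hq
      exact hcon ⟨i, hi, hne, fun q e => hq ⟨q, e⟩⟩
    obtain ⟨i, hi, hne, hq⟩ := hex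
    obtain ⟨b, hb⟩ := Finset.card_eq_one.mp hi
    have hab : a ≠ b := fun e => hne (hu (by rw [hb, hui₀, e])).symm
    have hbA : b ∈ A := Finset.mem_biUnion.mpr
      ⟨i, Finset.mem_filter.mpr ⟨Finset.mem_univ _, hi⟩, by rw [hb]; exact Finset.mem_singleton_self b⟩
    rw [Finset.mem_biUnion]
    refine ⟨{a, b}, Finset.mem_filter.mpr ⟨Finset.mem_powersetCard.mpr ⟨?_, Finset.card_pair hab⟩,
      fun q e => hq q (by rw [e, hui₀, hb]; rfl)⟩, by simp⟩
    intro x hx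
    rcases Finset.mem_insert.mp hx with rfl | hx
    · exact ha
    · rw [Finset.mem_singleton.mp hx]; exact hbA
  have hAle : A.card ≤ 2 * Miss.card := by
    refine (Finset.card_le_card hcov).trans (Finset.card_biUnion_le.trans (le_of_eq ?_))
    calc ∑ S ∈ Miss, (id S).card = ∑ S ∈ Miss, 2 := Finset.sum_congr rfl fun S hS =>
            (Finset.mem_powersetCard.mp (Finset.mem_filter.mp hS).1).2
      _ = 2 * Miss.card := by rw [Finset.sum_const, smul_eq_mul, Nat.mul_comm]
  have hC := add_two_mul_choose_two h
  omega

/-- **Near-full rows × a label star ⇒ hit** (`h ≥ 3`).  Rows: injective, thin, near-full.  Columns: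
a down-closed injective monomial basis `U` (`det [U i ⊆ w j] ≠ 0`) with a star of pair labels
`{v₀, v}`, `v ∈ K` (`|K| + 1 ≤ #singles`), holding the singleton of every used coordinate outside a
set `Dx` with `|Dx| ≤ 2·|K|`.  Then the layout is hit by `h·h` affine forms. -/
theorem chowHitsHH_of_nearFull_labelStar (h r : ℕ) (u w : Fin r → Finset (Fin h))
    (hu : Function.Injective u) (hu2 : ∀ i, (u i).card ≤ 2)
    (hnear : h * h < (Finset.univ.filter fun i : Fin r => (u i).card = 1).card + h +
      2 * (Finset.univ.filter fun i : Fin r => (u i).card = 2).card)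
    (U : Fin r → Finset (Fin h)) (hUinj : Function.Injective U)
    (hUdown : ∀ i (S : Finset (Fin h)), S ⊆ U i → ∃ i', U i' = S)
    (hZ : (Matrix.of fun i j : Fin r => if U i ⊆ w j then (1 : ℂ) else 0).det ≠ 0)
    (v₀ : Fin h) (K : Finset (Fin h)) (hv₀K : v₀ ∉ K) (hv₀U : ∃ j, U j = {v₀})
    (hKU : ∀ v ∈ K, ∃ j, U j = {v₀, v})
    (hKs : K.card + 1 ≤ (Finset.univ.filter fun i : Fin r => (u i).card = 1).card)
    (Dx : Finset (Fin h)) (hDx : Dx.card ≤ 2 * K.card)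
    (hUsing : ∀ c ∈ Finset.univ.biUnion w, c ∉ Dx → ∃ i, U i = {c}) :
    ∃ ℓ : Fin (h * h) → MvPolynomial (Fin (h + h)) ℂ, (∀ k, (ℓ k).totalDegree ≤ 1) ∧
      (Matrix.of fun i j : Fin r => MvPolynomial.coeff
        (∑ a ∈ u i, Finsupp.single (Fin.castAdd h a) 1 +
          ∑ c ∈ w j, Finsupp.single (Fin.natAdd h c) 1) (∏ k, ℓ k)).det ≠ 0 := by
  classical
  set Sing : Finset (Fin r) := Finset.univ.filter fun i : Fin r => (u i).card = 1 with hSing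
  obtain ⟨i₀, hi₀, hstar⟩ := exists_fullStar_of_nearFull u hu hnear
  obtain ⟨a₀, ha₀⟩ := Finset.card_eq_one.mp hi₀
  -- the other singleton coordinates
  set A' : Finset (Fin h) := (Sing.erase i₀).biUnion u with hA'
  have hi₀S : i₀ ∈ Sing := Finset.mem_filter.mpr ⟨Finset.mem_univ _, hi₀⟩
  have hA'card0 : A'.card = (Sing.erase i₀).card := by
    rw [hA', Finset.card_biUnion]
    · calc ∑ i ∈ Sing.erase i₀, (u i).card = ∑ i ∈ Sing.erase i₀, 1 :=
            Finset.sum_congr rfl fun i hi => (Finset.mem_filter.mp (Finset.mem_of_mem_erase hi)).2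
        _ = (Sing.erase i₀).card := by simp
    · intro i hi j hj hij
      obtain ⟨a, ha⟩ := Finset.card_eq_one.mp (Finset.mem_filter.mp (Finset.mem_of_mem_erase hi)).2
      obtain ⟨b, hb⟩ := Finset.card_eq_one.mp (Finset.mem_filter.mp (Finset.mem_of_mem_erase hj)).2
      show Disjoint (u i) (u j)
      rw [ha, hb, Finset.disjoint_singleton]
      intro e
      exact hij (hu (by rw [ha, hb, e]))
  have hA'card : A'.card = Sing.card - 1 := by
    rw [hA'card0, Finset.card_erase_of_mem hi₀S]
  have hA'row : ∀ x ∈ A', ∃ i, u i = {x} ∧ i ≠ i₀ := by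
    intro x hx
    obtain ⟨i, hi, hxi⟩ := Finset.mem_biUnion.mp hx
    obtain ⟨x', hx'⟩ := Finset.card_eq_one.mp (Finset.mem_filter.mp (Finset.mem_of_mem_erase hi)).2
    rw [hx'] at hxi
    exact ⟨i, by rw [hx', Finset.mem_singleton.mp hxi], Finset.ne_of_mem_erase hi⟩
  have ha₀A' : a₀ ∉ A' := by
    intro hx
    obtain ⟨i, hi, hne⟩ := hA'row a₀ hx
    exact hne (hu (hi.trans ha₀.symm))
  -- leaves: `B ⊆ A'` with `|B| = |K|`, a bijection `φ : B → K`
  obtain ⟨B, hBA', hBcard⟩ := Finset.exists_subset_card_eq (show K.card ≤ A'.card by rw [hA'card]; omega)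
  have haB : a₀ ∉ B := fun hx => ha₀A' (hBA' hx)
  have hcardBK : Fintype.card B = Fintype.card K := by rw [Fintype.card_coe, Fintype.card_coe, hBcard]
  set eBK : B ≃ K := Fintype.equivOfCardEq hcardBK with heBK
  set φ : Fin h → Fin h := fun x => if hx : x ∈ B then (eBK ⟨x, hx⟩ : Fin h) else v₀ with hφdef
  have hφK : ∀ x ∈ B, φ x ∈ K := fun x hx => by
    simp only [hφdef, dif_pos hx]; exact (eBK ⟨x, hx⟩).2
  have hφ : Set.InjOn φ B := by
    intro x hx x' hx' e
    simp only [Finset.mem_coe] at hx hx'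
    simp only [hφdef, dif_pos hx, dif_pos hx'] at e
    have := eBK.injective (Subtype.ext e)
    exact congrArg Subtype.val this
  have hv₀ : ∀ x ∈ B, φ x ≠ v₀ := fun x hx e => hv₀K (e ▸ hφK x hx)
  -- row maps
  have hσex : ∀ x ∈ insert a₀ B, ∃ i, u i = {x} := by
    intro x hx
    rcases Finset.mem_insert.mp hx with rfl | hx
    · exact ⟨i₀, ha₀⟩
    · obtain ⟨i, hi, -⟩ := hA'row x (hBA' hx); exact ⟨i, hi⟩
  set σ : Fin h → Fin r := fun x => if hx : ∃ i, u i = {x} then Classical.choose hx else i₀ with hσdef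
  have hσ : ∀ x ∈ insert a₀ B, u (σ x) = {x} := by
    intro x hx
    simp only [hσdef, dif_pos (hσex x hx)]
    exact Classical.choose_spec (hσex x hx)
  have hρex : ∀ x ∈ B, ∃ q, u q = {a₀, x} := by
    intro x hx
    obtain ⟨i, hi, hne⟩ := hA'row x (hBA' hx)
    obtain ⟨q, hq⟩ := hstar i (by rw [hi, Finset.card_singleton]) hne
    exact ⟨q, by rw [hq, ha₀, hi]; rfl⟩
  set ρ : Fin h → Fin r := fun x => if hx : ∃ q, u q = {a₀, x} then Classical.choose hx else i₀ with hρdef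
  have hρ : ∀ x ∈ B, u (ρ x) = {a₀, x} := by
    intro x hx
    simp only [hρdef, dif_pos (hρex x hx)]
    exact Classical.choose_spec (hρex x hx)
  have hKU' : ∀ x ∈ B, ∃ j, U j = {v₀, φ x} := fun x hx => hKU (φ x) (hφK x hx)
  exact chowHitsHH_of_xdedStar h r u w hu hu2 U hUinj hUdown hZ a₀ B haB σ hσ ρ hρ v₀ φ hφ hv₀ hv₀U
    hKU' Dx (by rw [hBcard]; exact hDx) hUsing

end Summit.ValiantsHypothesis.ValiantsHypothesis.Theorems.BarrierLever.ChowThinHH
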